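import Literature.Dynamics.Ergodic.PerronFrobeniusOperator
import Literature.Dynamics.Ergodic.ToralEndomorphismsKernelsDense
import Mathlib.Topology.Instances.Matrix
import HarnessLib

/-!
# The Perron–Frobenius operator of a toral endomorphism is the fibre average
# `P_{T_A} f (x) = |det A|⁻¹ Σ_{T_A y = x} f(y)` (Bezuglyi–Jorgensen (1.3)/(1.6), Lasota–Mackey (1.2.13))

Layer `Literature/Dynamics/Ergodic`, namespace `Literature.Dynamics.Ergodic` (sub-namespace `ToralEndomorphism`).
General dynamics file written for lane `lit-hodgefound` (prover seat `lit-hodgefound-p31`, row g22-#2); the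
`d`-torus version announced as «not formalised» in `AddCircleMultiplicationPerronFrobenius.lean` (the case
`d = 1`, `x ↦ n x mod 1`), with the same architecture; its lane file
`Literature/AlgebraicGeometry/HodgeTheory/AbelianVarietyIsogenyPerronFrobenius.lean` reads it on the complex points of
an abelian variety (`P_{f(ℂ)} g = (deg f)⁻¹ Σ_{f(ℂ) Q = P} g(Q)` for an isogeny `f`).

## The printed statements

* S. Bezuglyi, P. E. T. Jorgensen, *Transfer Operators, Endomorphisms, and Measurable Partitions* (LNM 2217, 2018),
  §1.2 (Galaxy text panama:274938036486154, chunks p0012–p0014): Example 1.2, for `σ(x) = 2x mod 1` on `[0, 1)` with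
  Lebesgue measure, «`R_σ(f)(x) := ½ (f(x/2) + f((x+1)/2))`» with (Table 1.1) `μ R_σ = μ`; eq. (1.3): for an
  `n`-to-one endomorphism `σ` and a weight `W`, «`R_σ(f)(x) = Σ_{y ∈ σ⁻¹(x)} W(y) f(y)`»; Example 1.3, eq. (1.6):
  `P` is a Frobenius–Perron operator for `(X, 𝓑, μ, σ)` if «`∫_A P(f) dμ = ∫_{σ⁻¹(A)} f dμ`» for all `f ∈ L¹(μ)`,
  `A ∈ 𝓑`.  THIS FILE: for the `|det A|`-to-one endomorphism `σ = T_A` of `(𝕋^d, Haar)` the Frobenius–Perron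
  operator (1.6) (the tree's `perronFrobenius T_A volume`, Dajani–Kalle Definition 6.1.1) is the transfer operator
  (1.3) with the constant weight `W = |det A|⁻¹`.
* A. Lasota, M. C. Mackey, *Chaos, Fractals, and Noise* (1994), §1.2 eq. (1.2.13) / §4.4 Example 4.4.2 (Galaxy text
  panama:430192514301980): «`Pf(x) = (1/r) Σ_{i=0}^{r−1} f(i/r + x/r)`» for `S(x) = r x (mod 1)` — the case `d = 1`.
* K. Dajani, C. Kalle, *A First Course in Ergodic Theory* (2021), §6.1 Definition 6.1.1 and §6.2, proof of Theorem
  6.2.2: «`P_T f ∘ T = 𝔼_μ(f | T⁻¹𝓕)`» (the tree's `perronFrobenius_comp_ae_eq_condExp`).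

## What is formalised (theorems only; no definition, no named fact)

* §0 (general) `perronFrobenius_map_comp_ae_eq`: **the Perron–Frobenius operator is a conjugacy invariant** — for a
  measurable equivalence `e : Ω ≃ Ω'` with `e ∘ T = T' ∘ e`, `P_{T'}^{e_* m} g ∘ e = P_T^m (g ∘ e)` `m`-a.e.
* §1 (the torus `𝕋^d = UnitAddTorus d`, `T x = (Σ_j A_{ij} x_j)_i`, `det A ≠ 0`): a measurable section of `T_A`
  (`exists_measurable_rightInverse`); the fibre through `y` is `y + ker T_A`;
  **`condExp_comap_ae_eq_kerAvg`**: `𝔼[f | T_A⁻¹𝓑] = |det A|⁻¹ Σ_{κ ∈ ker T_A} f(· + κ)` a.e.;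
  **`perronFrobenius_ae_eq_finsum_preimage`**: `P_{T_A} f = (x ↦ |det A|⁻¹ Σ_{T_A y = x} f(y))` a.e. for
  measurable integrable `f`; the iterates `P_{T_Aⁿ} f = |det A|⁻ⁿ Σ_{T_Aⁿ y = x} f(y)`;
* §2 multiplication by `m ≥ 1`: `P_{m·} f (x) = m^{-d} Σ_{m y = x} f(y)` (Lasota–Mackey (1.2.13) in `d` dimensions).

## References

* [BezuglyiJorgensen2018] S. Bezuglyi, P. E. T. Jorgensen, *Transfer Operators, Endomorphisms, and Measurable
  Partitions*, Lecture Notes in Math. 2217, Springer (2018), §1.2 Example 1.2, eqs. (1.3), (1.6) (Galaxy text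
  panama:274938036486154, chunks p0012–p0014).
* [LasotaMackey1994] A. Lasota, M. C. Mackey, *Chaos, Fractals, and Noise*, Applied Math. Sci. 97, Springer (1994),
  §1.2 eq. (1.2.13), §4.4 Example 4.4.2 (Galaxy text panama:430192514301980, chars 150000–172000).
* [DajaniKalle2021] K. Dajani, C. Kalle, *A First Course in Ergodic Theory*, CRC Press (2021), §6.1 Definition 6.1.1,
  §6.2 proof of Theorem 6.2.2 (held text chunks p0084, p0089).
* [DingZhou2009] J. Ding, A. Zhou, *Nonnegative Matrices, Positive Operators, and Applications* (2009), §8.2 eq. (8.3)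
  (held text chunk p0160: the invertible case `P_S f(x) = f(S⁻¹x) |dS⁻¹/dx|`).
* [Walters1982] P. Walters, *An Introduction to Ergodic Theory*, GTM 79 (1982), §0.8, §8.5 proof of Theorem 8.18
  (held text chunks p0043, p0214: `T_A` is `|det A|`-to-one).
-/

noncomputable section

open MeasureTheory MeasureTheory.Measure Set Filter Function Finset Matrix
open scoped ENNReal

namespace Literature.Dynamics.Ergodic

/-! ### §0 The Perron–Frobenius operator is a conjugacy invariant -/

section Conjugacy

variable {Ω Ω' : Type*} [MeasurableSpace Ω] [MeasurableSpace Ω'] {m : Measure Ω} [IsFiniteMeasure m]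

/-- **`P` is a conjugacy invariant**: for a measurable equivalence `e : Ω ≃ Ω'`, maps `T`, `T'` with
`e ∘ T = T' ∘ e`, `T` non-singular for `m` and `T'` non-singular for `e_* m`, and `g ∈ L¹(e_* m)`:
`P_{T'}^{e_* m} g ∘ e = P_T^{m} (g ∘ e)` `m`-a.e. (both have the integrals `∫_{T⁻¹A} g ∘ e dm` over every
measurable `A`, eq. (1.6)). [cite: BezuglyiJorgensen2018, §1.2 Example 1.3 eq. (1.6) (Galaxy text panama:274938036486154, chunk p0014)]
[cite: DajaniKalle2021, §6.1 Definition 6.1.1 (held text chunk p0084)] -/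
theorem perronFrobenius_map_comp_ae_eq (e : Ω ≃ᵐ Ω') {T : Ω → Ω} {T' : Ω' → Ω'}
    (hT : QuasiMeasurePreserving T m m) (hT' : QuasiMeasurePreserving T' (m.map e) (m.map e))
    (hconj : ∀ ω, e (T ω) = T' (e ω)) {g : Ω' → ℝ} (hg : Integrable g (m.map e)) :
    perronFrobenius T' (m.map e) g ∘ e =ᵐ[m] perronFrobenius T m (g ∘ e) := by
  haveI : IsFiniteMeasure (m.map e) := Measure.isFiniteMeasure_map m e
  have hge : Integrable (g ∘ e) m := (integrable_map_equiv e g).1 hg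
  have hPe : Integrable (perronFrobenius T' (m.map e) g ∘ e) m :=
    (integrable_map_equiv e _).1 (integrable_perronFrobenius T' hg)
  refine ae_eq_perronFrobenius_of_forall_setIntegral_eq hT hge hPe fun A hA _ ↦ ?_
  -- `∫_A (P g) ∘ e dm = ∫_{e A} P g d(e_* m) = ∫_{T'⁻¹(e A)} g d(e_* m) = ∫_{T⁻¹ A} g ∘ e dm`
  have hpre : e ⁻¹' (e '' A) = A := Set.preimage_image_eq A e.injective
  have h1 := e.measurableEmbedding.setIntegral_map (μ := m) (perronFrobenius T' (m.map e) g) (e '' A)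
  rw [hpre] at h1
  have h2 := e.measurableEmbedding.setIntegral_map (μ := m) g (T' ⁻¹' (e '' A))
  have hpre' : e ⁻¹' (T' ⁻¹' (e '' A)) = T ⁻¹' A := by
    ext ω
    rw [Set.mem_preimage, Set.mem_preimage, ← hconj ω, e.injective.mem_set_image, Set.mem_preimage]
  rw [hpre'] at h2
  change ∫ ω in A, perronFrobenius T' (m.map e) g (e ω) ∂m = ∫ ω in T ⁻¹' A, g (e ω) ∂m
  rw [← h1, ← h2, setIntegral_perronFrobenius hT' hg (e.measurableEmbedding.measurableSet_image.2 hA)]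

end Conjugacy

namespace ToralEndomorphism

variable {d : Type*} [Fintype d] [DecidableEq d] (A : Matrix d d ℤ)
  {T : UnitAddTorus d → UnitAddTorus d} (hT : ∀ x i, T x i = ∑ j, A i j • x j)

/-! ### §1 A measurable section of `T_A` and the fibres `T_A⁻¹{T_A y} = y + ker T_A` -/

omit [DecidableEq d] in
include hT in
/-- `T_A` is additive. [cite: Walters1982, §0.8 (held text chunk p0043)] -/
private theorem map_add_eq₃ (x y : UnitAddTorus d) : T (x + y) = T x + T y := by
  funext i
  rw [Pi.add_apply, hT, hT, hT, ← sum_add_distrib]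
  exact sum_congr rfl fun j _ ↦ by rw [Pi.add_apply, smul_add]

omit [DecidableEq d] in
include hT in
/-- `T_A (x − y) = T_A x − T_A y`. [cite: Walters1982, §0.8 (held text chunk p0043)] -/
private theorem map_sub_eq₃ (x y : UnitAddTorus d) : T (x - y) = T x - T y := by
  have h := map_add_eq₃ A hT (x - y) y
  rw [sub_add_cancel] at h
  exact eq_sub_of_add_eq h.symm

include hT in
/-- **A measurable section of `T_A`** (`det A ≠ 0`): `x ↦ A_ℝ⁻¹ x̃ mod ℤ^d`, `x̃ ∈ (0, 1]^d` the lift of `x`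
(Mathlib's `UnitAddTorus.measurableEquivPiIoc`), satisfies `T_A (s x) = x` — a Borel choice of one of the `|det A|`
preimages. [cite: Walters1982, §8.5 proof of Theorem 8.18 (held text chunk p0214)] -/
theorem exists_measurable_rightInverse (hA : A.det ≠ 0) :
    ∃ s : UnitAddTorus d → UnitAddTorus d, Measurable s ∧ ∀ x, T (s x) = x := by
  set Ar : Matrix d d ℝ := A.map (Int.cast : ℤ → ℝ) with hAr
  have hu : IsUnit Ar.det := by
    have : Ar.det = (A.det : ℝ) := by
      rw [hAr, show (Int.cast : ℤ → ℝ) = Int.castRingHom ℝ from rfl, RingHom.map_det, RingHom.mapMatrix_apply]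
    rw [this, isUnit_iff_ne_zero]
    exact_mod_cast hA
  set e := UnitAddTorus.measurableEquivPiIoc (0 : d → ℝ) with he
  refine ⟨fun x ↦ fun i ↦ (((Ar⁻¹ *ᵥ (e x).1) i : ℝ) : UnitAddCircle), ?_, ?_⟩
  · have hval : Measurable fun x : UnitAddTorus d ↦ ((e x).1 : d → ℝ) := measurable_subtype_coe.comp e.measurable
    have hmul : Measurable fun v : d → ℝ ↦ Ar⁻¹ *ᵥ v := (continuous_const.matrix_mulVec continuous_id).measurable
    exact measurable_pi_lambda _ fun i ↦
      AddCircle.measurable_mk'.comp ((measurable_pi_apply i).comp (hmul.comp hval))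
  · intro x
    rw [apply_coe A hT, ← hAr, Matrix.mulVec_mulVec, Matrix.mul_nonsing_inv _ hu, Matrix.one_mulVec]
    have h := e.symm_apply_apply x
    rwa [he, UnitAddTorus.coe_symm_measurableEquivPiIoc_apply] at h

omit [DecidableEq d] in
include hT in
/-- **The fibre of `T_A` through `y` is the coset `y + ker T_A`.** [cite: Walters1982, §8.5 proof of Theorem 8.18 (held text chunk p0214)] -/
theorem preimage_singleton_apply_eq_image (y : UnitAddTorus d) :
    T ⁻¹' {T y} = (fun κ ↦ y + κ) '' (T ⁻¹' ({0} : Set (UnitAddTorus d))) := by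
  ext y'
  simp only [Set.mem_preimage, Set.mem_singleton_iff, Set.mem_image]
  constructor
  · intro h
    refine ⟨y' - y, ?_, add_sub_cancel y y'⟩
    rw [map_sub_eq₃ A hT, h, sub_self]
  · rintro ⟨κ, hκ, rfl⟩
    rw [map_add_eq₃ A hT, hκ, add_zero]

omit [DecidableEq d] in
include hT in
/-- **Fibre sums are kernel sums**: `Σ_{T_A y' = T_A y} f(y') = Σ_{κ ∈ ker T_A} f(y + κ)`.
[cite: BezuglyiJorgensen2018, §1.2 eq. (1.3) (Galaxy text panama:274938036486154, chunk p0013)] -/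
theorem finsum_preimage_singleton_apply {M : Type*} [AddCommMonoid M] (f : UnitAddTorus d → M) (y : UnitAddTorus d) :
    ∑ᶠ y' ∈ T ⁻¹' {T y}, f y' = ∑ᶠ κ ∈ T ⁻¹' ({0} : Set (UnitAddTorus d)), f (y + κ) := by
  rw [preimage_singleton_apply_eq_image A hT y, finsum_mem_image (add_right_injective y).injOn]

/-! ### §2 `𝔼[f | T_A⁻¹𝓑]` is the average over the kernel -/

include hT in
/-- **The conditional expectation onto `T_A⁻¹𝓑` is the average over `ker T_A`**: for `det A ≠ 0` and
`f ∈ L¹(𝕋^d)` measurable, `𝔼[f | T_A⁻¹𝓑](y) = |det A|⁻¹ Σ_{κ ∈ ker T_A} f(y + κ)` for a.e. `y` — the average is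
`T_A⁻¹𝓑`-measurable (it is `F ∘ T_A` for the fibre average `F`, measurable through a Borel section) and has the
same integrals as `f` over the sets `T_A⁻¹B` (translation invariance of the Haar measure, `T_A(y + κ) = T_A y`).
This is the step «`P_T f ∘ T = 𝔼(f | T⁻¹𝓕)`» made explicit for the `|det A|`-to-one group endomorphism `T_A`.
[cite: DajaniKalle2021, §6.2 proof of Theorem 6.2.2 (held text chunk p0089)]
[cite: BezuglyiJorgensen2018, §1.2 Example 1.2 and eq. (1.3) (Galaxy text panama:274938036486154, chunks p0012–p0013)] -/
theorem condExp_comap_ae_eq_kerAvg (hA : A.det ≠ 0) {f : UnitAddTorus d → ℝ} (hfm : Measurable f)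
    (hf : Integrable f volume) :
    volume[f | MeasurableSpace.comap T MeasureSpace.pi.toMeasurableSpace] =ᵐ[volume]
      fun y ↦ (A.det.natAbs : ℝ)⁻¹ * ∑ᶠ κ ∈ T ⁻¹' ({0} : Set (UnitAddTorus d)), f (y + κ) := by
  have hS : MeasurePreserving T volume volume := measurePreserving A hT hA
  haveI : IsProbabilityMeasure (volume : Measure (UnitAddTorus d)) :=
    Literature.NumberTheory.DiophantineApproximation.KroneckerWeyl.isProbabilityMeasure_volume_unitAddTorus
  have hN0 : ((A.det.natAbs : ℕ) : ℝ) ≠ 0 := by exact_mod_cast Int.natAbs_ne_zero.2 hA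
  -- the kernel as a finite set
  have hK := finite_preimage_singleton A hT hA 0
  have hKmem : ∀ κ, κ ∈ hK.toFinset ↔ T κ = 0 := fun κ ↦ by
    rw [Set.Finite.mem_toFinset, Set.mem_preimage, Set.mem_singleton_iff]
  have hKcard : hK.toFinset.card = A.det.natAbs := by
    rw [← Set.ncard_eq_toFinset_card _ hK, ← Nat.card_coe_set_eq, natCard_preimage_singleton A hT hA 0]
  -- the fibre average downstairs, measurable through a Borel section
  set F : UnitAddTorus d → ℝ := fun x ↦ (A.det.natAbs : ℝ)⁻¹ * ∑ᶠ y ∈ T ⁻¹' {x}, f y with hFdef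
  set Av : UnitAddTorus d → ℝ := fun y ↦ (A.det.natAbs : ℝ)⁻¹ * ∑ κ ∈ hK.toFinset, f (y + κ) with hAvdef
  have hAv : ∀ y, (A.det.natAbs : ℝ)⁻¹ * ∑ᶠ κ ∈ T ⁻¹' ({0} : Set (UnitAddTorus d)), f (y + κ) = Av y := fun y ↦ by
    rw [hAvdef, finsum_mem_eq_finite_toFinset_sum _ hK]
  have hFT : ∀ y, F (T y) = Av y := fun y ↦ by
    rw [hFdef]
    beta_reduce
    rw [finsum_preimage_singleton_apply A hT f y, hAv y]
  obtain ⟨s, hsm, hs⟩ := exists_measurable_rightInverse A hT hA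
  have hAvm : Measurable Av :=
    measurable_const.mul (Finset.measurable_sum _ fun κ _ ↦ hfm.comp (measurable_add_const κ))
  have hFm : Measurable F := by
    have hF : F = fun x ↦ Av (s x) := funext fun x ↦ by rw [← hFT (s x), hs x]
    rw [hF]
    exact hAvm.comp hsm
  -- `Av = 𝔼[f | T⁻¹𝓑]`
  have hm : MeasurableSpace.comap T (MeasureSpace.pi.toMeasurableSpace : MeasurableSpace (UnitAddTorus d)) ≤
      MeasureSpace.pi.toMeasurableSpace := hS.measurable.comap_le
  have hAint : Integrable Av volume :=
    (integrable_finsetSum _ fun κ _ ↦ hf.comp_add_right κ).const_mul _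
  have hAcond : Av =ᵐ[volume] volume[f | MeasurableSpace.comap T MeasureSpace.pi.toMeasurableSpace] := by
    refine ae_eq_condExp_of_forall_setIntegral_eq hm hf (fun _ _ _ ↦ hAint.integrableOn) ?_ ?_
    · rintro _ ⟨B, hB, rfl⟩ -
      -- `∫_{T⁻¹B} f(y + κ) dy = ∫_{T⁻¹B} f` for `κ ∈ ker T`, by translation invariance and `T(y + κ) = T y`
      have hκ : ∀ κ ∈ hK.toFinset, ∫ y in T ⁻¹' B, f (y + κ) ∂volume = ∫ y in T ⁻¹' B, f y ∂volume := by
        intro κ hκK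
        rw [← integral_indicator (hS.measurable hB), ← integral_indicator (hS.measurable hB)]
        have hind : (T ⁻¹' B).indicator (fun y ↦ f (y + κ)) = fun y ↦ ((T ⁻¹' B).indicator f) (y + κ) := by
          funext y
          have hmem : y + κ ∈ T ⁻¹' B ↔ y ∈ T ⁻¹' B := by
            rw [Set.mem_preimage, Set.mem_preimage, map_add_eq₃ A hT, (hKmem κ).1 hκK, add_zero]
          by_cases hy : y ∈ T ⁻¹' B
          · rw [indicator_of_mem hy, indicator_of_mem (hmem.2 hy)]
          · rw [indicator_of_notMem hy, indicator_of_notMem (fun h ↦ hy (hmem.1 h))]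
        rw [hind]
        exact integral_add_right_eq_self _ κ
      rw [integral_const_mul, integral_finsetSum _ fun κ _ ↦ (hf.comp_add_right _).integrableOn,
        Finset.sum_congr rfl hκ, Finset.sum_const, hKcard, nsmul_eq_mul, ← mul_assoc, inv_mul_cancel₀ hN0,
        one_mul]
    · have hTm : Measurable[MeasurableSpace.comap T MeasureSpace.pi.toMeasurableSpace] T :=
        measurable_iff_comap_le.2 le_rfl
      have : Av = F ∘ T := funext fun y ↦ (hFT y).symm
      rw [this]
      exact (hFm.comp hTm).stronglyMeasurable.aestronglyMeasurable
  filter_upwards [hAcond] with y hy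
  rw [← hy, hAv y]

/-! ### §3 `P_{T_A} f` is the fibre average -/

include hT in
/-- **The Perron–Frobenius operator of a toral endomorphism is the fibre average: for `det A ≠ 0` and a measurable
`f ∈ L¹(𝕋^d, Haar)`, `P_{T_A} f (x) = |det A|⁻¹ Σ_{T_A y = x} f(y)` for a.e. `x`** — Bezuglyi–Jorgensen's transfer
operator (1.3) with the constant weight `W = 1/|det A|` on the `|det A|` points of each fibre is the
Frobenius–Perron operator (1.6) of `(𝕋^d, 𝓑, Haar, T_A)` (Example 1.2: «`R_σ(f)(x) = ½(f(x/2) + f((x+1)/2))`»,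
`μR_σ = μ`, for `σ(x) = 2x mod 1`; Lasota–Mackey (1.2.13) for `x ↦ r x mod 1`).  Proof: `P_{T_A} f ∘ T_A =
𝔼[f | T_A⁻¹𝓑]` (`perronFrobenius_comp_ae_eq_condExp`) `=` the kernel average `=` (fibre average) `∘ T_A` a.e.
(§2), and an a.e. identity `u ∘ T_A = v ∘ T_A` descends to `u = v` since `T_A` preserves the Haar measure.
[cite: BezuglyiJorgensen2018, §1.2 Example 1.2, eqs. (1.3), (1.6) (Galaxy text panama:274938036486154, chunks p0012–p0014)]
[cite: LasotaMackey1994, §1.2 eq. (1.2.13) and §4.4 Example 4.4.2 (Galaxy text panama:430192514301980, chars 150000–172000)]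
[cite: DajaniKalle2021, §6.1 Definition 6.1.1, §6.2 proof of Theorem 6.2.2 (held text chunks p0084, p0089)] -/
theorem perronFrobenius_ae_eq_finsum_preimage (hA : A.det ≠ 0) {f : UnitAddTorus d → ℝ} (hfm : Measurable f)
    (hf : Integrable f volume) :
    perronFrobenius T volume f =ᵐ[volume] fun x ↦ (A.det.natAbs : ℝ)⁻¹ * ∑ᶠ y ∈ T ⁻¹' {x}, f y := by
  have hS : MeasurePreserving T volume volume := measurePreserving A hT hA
  haveI : IsProbabilityMeasure (volume : Measure (UnitAddTorus d)) :=
    Literature.NumberTheory.DiophantineApproximation.KroneckerWeyl.isProbabilityMeasure_volume_unitAddTorus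
  set F : UnitAddTorus d → ℝ := fun x ↦ (A.det.natAbs : ℝ)⁻¹ * ∑ᶠ y ∈ T ⁻¹' {x}, f y with hFdef
  -- `F ∘ T` is the kernel average, `F` is measurable through a Borel section
  have hFT : ∀ y, F (T y) = (A.det.natAbs : ℝ)⁻¹ * ∑ᶠ κ ∈ T ⁻¹' ({0} : Set (UnitAddTorus d)), f (y + κ) :=
    fun y ↦ by
      rw [hFdef]
      beta_reduce
      rw [finsum_preimage_singleton_apply A hT f y]
  have hK := finite_preimage_singleton A hT hA 0
  obtain ⟨s, hsm, hs⟩ := exists_measurable_rightInverse A hT hA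
  have hFm : Measurable F := by
    have hF : F = fun x ↦ (A.det.natAbs : ℝ)⁻¹ * ∑ κ ∈ hK.toFinset, f (s x + κ) := funext fun x ↦ by
      rw [← hs x, hFT (s x), hs x, finsum_mem_eq_finite_toFinset_sum _ hK]
    rw [hF]
    exact measurable_const.mul (Finset.measurable_sum _ fun κ _ ↦ hfm.comp (hsm.add_const κ))
  -- `P_T f ∘ T = 𝔼[f | T⁻¹𝓑] = F ∘ T` a.e.
  have hPT : perronFrobenius T volume f ∘ T =ᵐ[volume] F ∘ T := by
    filter_upwards [perronFrobenius_comp_ae_eq_condExp hS hf, condExp_comap_ae_eq_kerAvg A hT hA hfm hf]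
      with y hy hA'
    rw [hy, hA', Function.comp_apply, hFT]
  -- descend along the measure-preserving `T`
  have hne : MeasurableSet {x | perronFrobenius T volume f x ≠ F x} :=
    (measurableSet_eq_fun (measurable_perronFrobenius T volume f) hFm).compl
  have h0 : volume {x | perronFrobenius T volume f x ≠ F x} = 0 := by
    rw [← hS.measure_preimage hne.nullMeasurableSet]
    refine measure_eq_zero_iff_ae_notMem.2 ?_
    filter_upwards [hPT] with y hy
    simpa using hy
  refine (measure_eq_zero_iff_ae_notMem.1 h0).mono fun x hx ↦ ?_
  have hx' : perronFrobenius T volume f x = F x := by simpa using hx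
  exact hx'

include hT in
/-- **The iterates: `P_{T_Aⁿ} f (x) = |det A|⁻ⁿ Σ_{T_Aⁿ y = x} f(y)` a.e.** (`T_Aⁿ = T_{Aⁿ}`, `det Aⁿ = (det A)ⁿ`;
with the tree's `perronFrobenius_iterate` this is also the `n`-fold iterate `P_{T_A}ⁿ f`).
[cite: BezuglyiJorgensen2018, §1.2 eq. (1.3) (Galaxy text panama:274938036486154, chunk p0013)]
[cite: DajaniKalle2021, §6.1 Proposition 6.1.2 (held text chunk p0084)] -/
theorem perronFrobenius_iterate_ae_eq_finsum_preimage (hA : A.det ≠ 0) {f : UnitAddTorus d → ℝ}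
    (hfm : Measurable f) (hf : Integrable f volume) (n : ℕ) :
    perronFrobenius T^[n] volume f =ᵐ[volume]
      fun x ↦ ((A.det.natAbs : ℝ) ^ n)⁻¹ * ∑ᶠ y ∈ (T^[n]) ⁻¹' {x}, f y := by
  have h := perronFrobenius_ae_eq_finsum_preimage (A ^ n) (T := T^[n]) (iterate_apply A hT n)
    (by rw [det_pow]; exact pow_ne_zero _ hA) hfm hf
  simp_rw [det_pow, Int.natAbs_pow, Nat.cast_pow] at h
  exact h

include hT in
/-- **`P_{T_A}ⁿ f (x) = |det A|⁻ⁿ Σ_{T_Aⁿ y = x} f(y)` a.e.** for the `n`-fold iterate of the operator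
(`perronFrobenius_iterate`: `P_{Tⁿ} = P_Tⁿ`). [cite: DajaniKalle2021, §6.1 Proposition 6.1.2 (held text chunk p0084)]
[cite: BezuglyiJorgensen2018, §1.2 eq. (1.3) (Galaxy text panama:274938036486154, chunk p0013)] -/
theorem iterate_perronFrobenius_ae_eq_finsum_preimage (hA : A.det ≠ 0) {f : UnitAddTorus d → ℝ}
    (hfm : Measurable f) (hf : Integrable f volume) (n : ℕ) :
    (perronFrobenius T volume)^[n] f =ᵐ[volume]
      fun x ↦ ((A.det.natAbs : ℝ) ^ n)⁻¹ * ∑ᶠ y ∈ (T^[n]) ⁻¹' {x}, f y := by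
  haveI : IsProbabilityMeasure (volume : Measure (UnitAddTorus d)) :=
    Literature.NumberTheory.DiophantineApproximation.KroneckerWeyl.isProbabilityMeasure_volume_unitAddTorus
  exact (perronFrobenius_iterate (measurePreserving A hT hA).quasiMeasurePreserving hf n).symm.trans
    (perronFrobenius_iterate_ae_eq_finsum_preimage A hT hA hfm hf n)

end ToralEndomorphism

/-! ### §4 Multiplication by `m`: `P_{m·} f (x) = m^{-d} Σ_{m y = x} f(y)` (Lasota–Mackey (1.2.13) on `𝕋^d`) -/

section Nsmul

variable {d : Type*} [Fintype d]

/-- **The Perron–Frobenius operator of `y ↦ m • y` on `𝕋^d` (`m ≥ 1`): `P f (x) = m^{-d} Σ_{m y = x} f(y)` a.e.**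
for measurable `f ∈ L¹` — Lasota–Mackey's (1.2.13) «`Pf(x) = (1/r) Σ_{i<r} f(i/r + x/r)`» in `d` dimensions (the
`m^d` solutions of `m y = x`). [cite: LasotaMackey1994, §1.2 eq. (1.2.13) and §4.4 Example 4.4.2 (Galaxy text panama:430192514301980, chars 150000–172000)]
[cite: BezuglyiJorgensen2018, §1.2 Example 1.2 eq. (1.3) (Galaxy text panama:274938036486154, chunks p0012–p0013)] -/
theorem perronFrobenius_nsmul_ae_eq_finsum_preimage {m : ℕ} (hm : 0 < m) {f : UnitAddTorus d → ℝ}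
    (hfm : Measurable f) (hf : Integrable f volume) :
    perronFrobenius (fun y : UnitAddTorus d ↦ m • y) volume f =ᵐ[volume]
      fun x ↦ ((m : ℝ) ^ Fintype.card d)⁻¹ * ∑ᶠ y ∈ (fun z : UnitAddTorus d ↦ m • z) ⁻¹' {x}, f y := by
  classical
  have hTm : ∀ (x : UnitAddTorus d) (i : d), (m • x) i = ∑ j, (((m : ℤ) • (1 : Matrix d d ℤ)) i j) • x j :=
    fun x i ↦ by
      simp only [Matrix.smul_apply, Matrix.one_apply, smul_eq_mul, mul_ite, mul_one, mul_zero, ite_smul,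
        zero_smul, Finset.sum_ite_eq, Finset.mem_univ, if_true, Pi.smul_apply, natCast_zsmul]
  have hdet : (((m : ℤ) • (1 : Matrix d d ℤ))).det ≠ 0 := by
    rw [Matrix.det_smul, Matrix.det_one, mul_one]
    exact pow_ne_zero _ (by exact_mod_cast hm.ne')
  have h := ToralEndomorphism.perronFrobenius_ae_eq_finsum_preimage ((m : ℤ) • (1 : Matrix d d ℤ))
    (T := fun y : UnitAddTorus d ↦ m • y) hTm hdet hfm hf
  simp_rw [Matrix.det_smul, Matrix.det_one, mul_one, Int.natAbs_pow, Int.natAbs_natCast, Nat.cast_pow] at h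
  exact h

end Nsmul

end Literature.Dynamics.Ergodic
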